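import Summits.QuantumFields.YangMills.Theorems.UnitScaleGibbsNormalEquationNetFlux
import Summits.QuantumFields.YangMills.Theorems.UnitScaleGibbsBlockPlaquetteLinWeightDefs
import HarnessLib

/-!
# `UnitScaleGibbsNormalEquationNetFluxLinWeight` — THE BLOCK-PLAQUETTE WEIGHT CARRIES NET FLUX `(L²)^j`, SO (LIN-ID)'s NORMAL
# EQUATIONS HAVE NO BOX-LOCAL SOLUTION FOR IT (file 2 of 2 of the net-flux obstruction inside LINE 28 «GrossTransfer»)

Cell `ym3-torus` (rung R3 — NOT d = 4, NOT infinite volume, NOT a mass gap, NOT Clay), crux of record `UnitScaleTilt.HistoryTailL`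
(stmt-QuantumFields-19936), width seat `ym-ust-19936-w5` gen 16.  File 1 ✓`UnitScaleGibbsNormalEquationNetFlux` proved: for `w` supported in
the plaquettes of a non-wrapping box with a NONZERO orientation sum and any `u : PBond → ℝ` with box-supported curl (e.g. margin-1 support),
the normal equations `∀ B, Σ_p ((du)_p − w_p)·(dB)_p = 0` (the `hN` of (LIN-ID) v1 — what a knit needs to kill the defect
`D_α = ⟨w − du, dg_α⟩` displayed by ✓`UnitScaleGibbsLinProxyFluxIdentification` v2 — and their off-tree weakening) are FALSE.  THIS FILE supplies the LINE-28 instance: the nested offset-mean weight `linWeight j a`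
(✓`UnitScaleGibbsBlockPlaquetteLinWeightDefs`, the weight of (M3♭)'s linear proxy `Σ_p linWeight j a p • (V(∂p) − 1)`) vanishes off the
orientation of `a` (`linWeight_eq_zero_of_orientation_ne`) and has orientation sum `(L·L)^j ≠ 0` (`sum_ite_linWeight`, from ✓`sum_linWeight`);
hence ★`not_normalEq_linWeight` / ★`not_normalEq_linWeight_of_margin`: for EVERY non-wrapping box of the level-`0` torus whose plaquettes
contain `supp (linWeight j a)` and EVERY `u` with box-supported curl — in particular every `u` with the margin-1 support row of `stub_linTest`
— the normal equations against `linWeight j a` FAIL, in both the unrestricted and the off-tree form.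

HONEST SCOPE.  Finite sums; proves no stub and refutes no registered statement (`stub_linTest` is an `∃`-statement trivially implied by
«ShallowFluxSecondMomentL» with `u := 0`); it shows that the line's DESIGNED identification «`⟨w,A⟩ = ⟨du⁰,dA⟩` for the box least-squares
potential» has no instance for the block plaquette.  Nothing of (Q), 23083/23133/23134, K1, `HistoryTailL` or the rung is proved; YM₃ on T³
is rung R3 — NOT d = 4, NOT a mass gap, NOT Clay.

References: T. Bałaban, CMP **98** (1985) 17–51 [Balaban1985Averaging] ((47)–(48) pp.25–26: the averaging weights, total mass `L²` per step);
L. Gross, CMP **92** (1983) 137–162 [GrossCMP1983] (Thm 2.2).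
-/

set_option autoImplicit false

noncomputable section

open scoped BigOperators
open Literature.MathematicalPhysics.QuantumFieldTheory.Balaban1983to89
open Literature.MathematicalPhysics.QuantumFieldTheory.Balaban1983to89.T4AxialGaugeSmallField (castSite boxPlaqs)
open Literature.MathematicalPhysics.QuantumFieldTheory.Balaban1983to89.B7Prop1Explicit (e)
open Literature.MathematicalPhysics.QuantumFieldTheory.Balaban1983to89.B8Lemma1NonAbelian (lowPart)
open Summit.QuantumFields.YangMills.Theorems.UnitScaleGibbsActionDerivativeSlotCalculus (slotBond)
open Summit.QuantumFields.YangMills.Theorems.UnitScaleGibbsBlockPlaquetteLinWeight (linWeight linWeight_succ linWeight_zero_of_ne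
  sum_linWeight)
open Summit.QuantumFields.YangMills.Theorems.UnitScaleGibbsNormalEquationNetFlux (not_normalEq_of_orientationSum_ne_zero
  not_offTree_normalEq_of_orientationSum_ne_zero not_normalEq_of_margin curl_support_of_margin)

namespace Summit.QuantumFields.YangMills.Theorems.UnitScaleGibbsNormalEquationNetFluxLinWeight

variable {P : Params}

/-! ## The LINE-28 instance: the block-plaquette weight `linWeight j a` carries net flux `(L²)^j` -/

/-- `linWeight j a` lives on the orientation of `a`: `linWeight j a p = 0` unless `p.μ = a.μ ∧ p.ν = a.ν` (the tiles of the recursion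
carry the orientation of the coarse plaquette). [cite: Balaban1985Averaging, (47)-(48) pp.25-26] -/
theorem linWeight_eq_zero_of_orientation_ne : ∀ (j : ℕ) (a : Plaq P j) (p : Plaq P 0),
    ¬ (p.μ = a.μ ∧ p.ν = a.ν) → linWeight j a p = 0
  | 0, a, p, h => by
    refine linWeight_zero_of_ne fun hap => h ?_
    subst hap
    exact ⟨rfl, rfl⟩
  | j + 1, a, p, h => by
    rw [linWeight_succ]
    refine mul_eq_zero_of_right _ (Finset.sum_eq_zero fun J _ => Finset.sum_eq_zero fun t _ => Finset.sum_eq_zero fun s _ => ?_)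
    exact linWeight_eq_zero_of_orientation_ne j _ p (by simpa using h)

/-- **NET FLUX OF THE BLOCK-PLAQUETTE WEIGHT**: `Σ_p [p.μ = a.μ ∧ p.ν = a.ν]·linWeight j a p = (L·L)^j` (all the mass of ✓`sum_linWeight`
sits on the orientation of `a`). [cite: Balaban1985Averaging, (47)-(48) pp.25-26] -/
theorem sum_ite_linWeight (j : ℕ) (a : Plaq P j) :
    ∑ p : Plaq P 0, (if p.μ = a.μ ∧ p.ν = a.ν then linWeight j a p else 0) = ((P.L : ℝ) * P.L) ^ j := by
  rw [← sum_linWeight j a]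
  refine Finset.sum_congr rfl fun p _ => ?_
  split_ifs with h
  · rfl
  · exact (linWeight_eq_zero_of_orientation_ne j a p h).symm

/-- The net flux is nonzero: `(L·L)^j ≠ 0`. [folklore] -/
theorem sum_ite_linWeight_ne_zero (j : ℕ) (a : Plaq P j) :
    ∑ p : Plaq P 0, (if p.μ = a.μ ∧ p.ν = a.ν then linWeight j a p else 0) ≠ 0 := by
  rw [sum_ite_linWeight]
  have hL : (0 : ℝ) < P.L := by exact_mod_cast P.L_pos
  positivity

/-- ★★★ **NO BOX-LOCAL LEAST-SQUARES POTENTIAL FOR THE BLOCK PLAQUETTE** ((LIN-ID) v1's `hN` cannot be met box-locally): for every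
`j`, every coarse plaquette `a`, every non-wrapping box `[lo, hi]` of the level-`0` torus whose plaquettes contain the support of
`linWeight j a`, and every bond field `u` whose curl is supported in that box, the normal equations
`∀ B, Σ_p ((du)_p − linWeight j a p)·(dB)_p = 0` are FALSE. [cite: GrossCMP1983, Thm 2.2] -/
theorem not_normalEq_linWeight {lo hi : Fin P.d → ℤ} (hN : ∀ κ, hi κ - lo κ < P.sitesPerDir 0) (j : ℕ) (a : Plaq P j)
    (hw : ∀ p : Plaq P 0, linWeight j a p ≠ 0 → p ∈ boxPlaqs lo hi) (u : PBond P 0 → ℝ)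
    (hu : ∀ p : Plaq P 0, u (slotBond p 0) + u (slotBond p 1) - u (slotBond p 2) - u (slotBond p 3) ≠ 0 → p ∈ boxPlaqs lo hi) :
    ¬ ∀ B : PBond P 0 → ℝ,
        ∑ p : Plaq P 0, ((u (slotBond p 0) + u (slotBond p 1) - u (slotBond p 2) - u (slotBond p 3)) - linWeight j a p) *
          (B (slotBond p 0) + B (slotBond p 1) - B (slotBond p 2) - B (slotBond p 3)) = 0 :=
  not_normalEq_of_orientationSum_ne_zero hN (linWeight j a) u hw hu a.hμν (sum_ite_linWeight_ne_zero j a)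

/-- ★★★ **… in particular for the margin-1 test fields of `stub_linTest`** (support row `lo + 1 ≤ x ∧ x + e_{b.dir} + 1 ≤ hi ∧
b.src = castSite x`, the off-tree clause being irrelevant): the off-tree AND the unrestricted normal equations against `linWeight j a`
both FAIL. [cite: GrossCMP1983, Thm 2.2] -/
theorem not_normalEq_linWeight_of_margin {lo hi : Fin P.d → ℤ} (hN : ∀ κ, hi κ - lo κ < P.sitesPerDir 0) (j : ℕ) (a : Plaq P j)
    (hw : ∀ p : Plaq P 0, linWeight j a p ≠ 0 → p ∈ boxPlaqs lo hi) (u : PBond P 0 → ℝ)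
    (hsupp : ∀ b, u b ≠ 0 → ∃ x : Fin P.d → ℤ, lo + 1 ≤ x ∧ x + e b.dir + 1 ≤ hi ∧ b.src = castSite x) :
    (¬ ∀ B : PBond P 0 → ℝ,
        (∀ b, B b ≠ 0 → ∃ x : Fin P.d → ℤ, lo ≤ x ∧ x + e b.dir ≤ hi ∧ b.src = castSite x ∧ lowPart b.dir (x - lo) ≠ 0) →
        ∑ p : Plaq P 0, ((u (slotBond p 0) + u (slotBond p 1) - u (slotBond p 2) - u (slotBond p 3)) - linWeight j a p) *
          (B (slotBond p 0) + B (slotBond p 1) - B (slotBond p 2) - B (slotBond p 3)) = 0) ∧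
    (¬ ∀ B : PBond P 0 → ℝ,
        ∑ p : Plaq P 0, ((u (slotBond p 0) + u (slotBond p 1) - u (slotBond p 2) - u (slotBond p 3)) - linWeight j a p) *
          (B (slotBond p 0) + B (slotBond p 1) - B (slotBond p 2) - B (slotBond p 3)) = 0) :=
  ⟨not_offTree_normalEq_of_orientationSum_ne_zero hN (linWeight j a) u hw (curl_support_of_margin u hsupp) a.hμν
      (sum_ite_linWeight_ne_zero j a),
    not_normalEq_of_margin hN (linWeight j a) u hw hsupp a.hμν (sum_ite_linWeight_ne_zero j a)⟩

end Summit.QuantumFields.YangMills.Theorems.UnitScaleGibbsNormalEquationNetFluxLinWeight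

end
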